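import Summits.HodgeConjecture.HodgeConjecture.Theses.AnchorTransport
import Summits.HodgeConjecture.HodgeConjecture.Theorems.AnchorTransportIsoInvariance

/-!
# Route AnchorTransport — `AnchorExistence` (item stmt-HodgeConjecture-1077): transport and tightness bookkeeping

Support lemmas for the crux `AnchorExistence`, complementary to the constant-family file
`AnchorTransportAnchorExistenceConstantFamily`:

* `anchorTransport_anchor_map_of_iso` — anchoring data transport along isomorphisms of the anchored
  variety: an anchor datum `(f, s₁, s₀, e, A)` for `(X, c)` is one for `(X', g^* c)` with `e' = g ≫ e`, for
  every `g : X' ≅ X` over `ℂ` (so lines may replace `X` by a standard model, e.g. the Fermat hypersurface).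
* `anchorTransport_mem_algebraicClasses_of_anchor_of_fiberIso` — ISOTRIVIAL ANCHORS GIVE NOTHING NEW:
  if the anchor fibre `𝒳_{s₀}` is isomorphic to the fibre `𝒳_{s₁}` through an isomorphism carrying
  `A|_{𝒳_{s₀}}` to `A|_{𝒳_{s₁}}`, then `c` itself is algebraic (the route's proved `IsoInvariance`, twice).
  This is the typable shadow of "An ≡ HC on rigid pairs" (crux notes `Cruxes/AnchorExistence/IdeatorTwoNotes.md` §1).
* `anchorTransport_variationalHodge_iff_hodgeConjecture_of_anchorExistence` — modulo `AnchorExistence`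
  and the tier-0 debt `HodgeModels`, the other crux `VariationalHodge` is equivalent to the summit
  (`HC ⇒ V` fibrewise; `V ⇒ HC` by the deciding theorem `closes`).
-/

noncomputable section

set_option linter.dupNamespace false

open CategoryTheory AlgebraicGeometry
open Literature.AlgebraicGeometry Literature.AlgebraicGeometry.Motives
  Literature.AlgebraicGeometry.HodgeTheory

namespace Summit.HodgeConjecture.HodgeConjecture.Theorems

open Summit.HodgeConjecture.HodgeConjecture.Theses.AnchorTransport

/-- **Anchor data transport along isomorphisms of the anchored variety.** If `(X, c)` admits the
anchoring data of `AnchorExistence` (family `f`, points `s₁, s₀`, `e : X ≅ 𝒳_{s₁}`, global class `A`)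
and `g : X' ≅ X` is an isomorphism of `ℂ`-schemes, then `(X', g^* c)` admits the same data with
`e' = g ≫ e` (`(g ≫ e)^* = g^* ∘ e^*`, contravariant functoriality of `H^{2p}(–(ℂ); ℂ)`).
[cite: FultonYoungTableaux1997, Appendix B §B.1 (1)] -/
theorem anchorTransport_anchor_map_of_iso {n p : ℕ} {X X' : SchemeOver ℂ} (g : X' ≅ X)
    {c : complexBetti X (2 * p)}
    (h : ∃ (𝒳 S : SchemeOver ℂ) (f : 𝒳 ⟶ S) (s₁ s₀ : ComplexPoints S) (e : X ≅ fiberOver f s₁)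
      (A : complexBetti 𝒳 (2 * p)),
      IsSmoothProjectiveFamily f n ∧ IrreducibleSpace S.left ∧ AlgebraicGeometry.Smooth S.hom ∧
      (∀ s : ComplexPoints S, IsRationalClass (complexBetti.map (fiberι f s) (2 * p) A) ∧
        IsOfHodgeType n (fiberOver f s) (2 * p) p p (complexBetti.map (fiberι f s) (2 * p) A)) ∧
      complexBetti.map e.hom (2 * p) (complexBetti.map (fiberι f s₁) (2 * p) A) = c ∧
      complexBetti.map (fiberι f s₀) (2 * p) A ∈ algebraicClasses (fiberOver f s₀) p) :
    ∃ (𝒳 S : SchemeOver ℂ) (f : 𝒳 ⟶ S) (s₁ s₀ : ComplexPoints S) (e : X' ≅ fiberOver f s₁)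
      (A : complexBetti 𝒳 (2 * p)),
      IsSmoothProjectiveFamily f n ∧ IrreducibleSpace S.left ∧ AlgebraicGeometry.Smooth S.hom ∧
      (∀ s : ComplexPoints S, IsRationalClass (complexBetti.map (fiberι f s) (2 * p) A) ∧
        IsOfHodgeType n (fiberOver f s) (2 * p) p p (complexBetti.map (fiberι f s) (2 * p) A)) ∧
      complexBetti.map e.hom (2 * p) (complexBetti.map (fiberι f s₁) (2 * p) A) =
        complexBetti.map g.hom (2 * p) c ∧
      complexBetti.map (fiberι f s₀) (2 * p) A ∈ algebraicClasses (fiberOver f s₀) p := by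
  obtain ⟨𝒳, S, f, s₁, s₀, e, A, hf, hirr, hsm, hfib, hAc, hs₀⟩ := h
  refine ⟨𝒳, S, f, s₁, s₀, g ≪≫ e, A, hf, hirr, hsm, hfib, ?_, hs₀⟩
  rw [← hAc, Iso.trans_hom, complexBetti.map_comp]
  rfl

/-- **Isotrivial anchors give nothing new.** In an anchor datum for `(X, c)`, if the anchor fibre is
isomorphic to the fibre carrying `c` through `g : 𝒳_{s₁} ≅ 𝒳_{s₀}` with `g^*(A|_{𝒳_{s₀}}) = A|_{𝒳_{s₁}}`
(as happens, after finite étale base change, in an isotrivial family — e.g. through a rigid non-uniruled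
`X`), then `c` is ALREADY algebraic on `X`: algebraic classes are transported by `g` and by `e`
(the route's proved `IsoInvariance`, `anchorTransport_isoInvariance_proof`). So the content of
`AnchorExistence` beyond the Hodge conjecture at `(X, c)` lies entirely in anchors NOT compatibly
isomorphic to the original fibre. [cite: Fulton1998, §19.1] -/
theorem anchorTransport_mem_algebraicClasses_of_anchor_of_fiberIso {p : ℕ} {X 𝒳 S : SchemeOver ℂ}
    (f : 𝒳 ⟶ S) (s₁ s₀ : ComplexPoints S) (e : X ≅ fiberOver f s₁) (A : complexBetti 𝒳 (2 * p))
    {c : complexBetti X (2 * p)}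
    (hAc : complexBetti.map e.hom (2 * p) (complexBetti.map (fiberι f s₁) (2 * p) A) = c)
    (hs₀ : complexBetti.map (fiberι f s₀) (2 * p) A ∈ algebraicClasses (fiberOver f s₀) p)
    (g : fiberOver f s₁ ≅ fiberOver f s₀)
    (hg : complexBetti.map g.hom (2 * p) (complexBetti.map (fiberι f s₀) (2 * p) A) =
      complexBetti.map (fiberι f s₁) (2 * p) A) :
    c ∈ algebraicClasses X p := by
  rw [← hAc, ← hg]
  exact anchorTransport_isoInvariance_proof e p _ (anchorTransport_isoInvariance_proof g p _ hs₀)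

/-- **Modulo `AnchorExistence` and the tier-0 debt `HodgeModels`, the crux `VariationalHodge` is
EQUIVALENT to the Hodge conjecture**: `←` is fibrewise (every fibre of a smooth projective family is
smooth projective, `IsSmoothProjectiveFamily.isSmoothProjective`, and `A|_{𝒳_s}` is a rational
`(p,p)`-class there; the anchor and the hypotheses on `S` are not used), `→` is the deciding theorem
`closes` with the proved `IsoInvariance`. Companion of `anchorTransport_anchorExistence_iff_hodgeConjecture`.
[cite: Deligne2000, §1] -/
theorem anchorTransport_variationalHodge_iff_hodgeConjecture_of_anchorExistence (hAn : AnchorExistence)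
    (hM : HodgeModels) : VariationalHodge ↔ _root_.HodgeConjecture :=
  ⟨fun hV => closes hV hAn anchorTransport_isoInvariance_proof hM,
    fun hHC _ _ _ _ hf _ _ p _ hA _ s => (hHC (hf.isSmoothProjective s)).2 p _ (hA s).1 (hA s).2⟩

end Summit.HodgeConjecture.HodgeConjecture.Theorems

end
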